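/-
Copyright (c) 2026 the pub-hodgecm-mathlib formalisation cell (harness21).  Prover seat hodgecm-mathlib-K2E3-p23 (g5), HCML Track B «K2-LIT» ∕ h413
(`stmt-HodgeConjecture-24833`), line `K2_E3_EllipticInputs`, unit U12 «Characters», road «GL-[M6]-sc» (line lead K2E3-p23 (g5), dealer K2E3-plan (g3)),
MEMO «M6sc-BLUEPRINT v4» §1 (ASM): the `hball` majorant at an INTEGRAL REPRESENTATIVE, split case.  2026-09-04.
-/
import Summits.HodgeConjecture.HodgeConjecture.Theorems.K2E3GL3ModUniformizerBallBoundSplit     -- ★ p858357 (this seat): the split mouth; brings VOL-transfer, V4, T18-split, shift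
import HarnessLib

/-!
# Road «GL-[M6]-sc», ASM brick: THE SPLIT BALL BOUND AT AN INTEGRAL REPRESENTATIVE `g₁ = y · diag d · y⁻¹` OF HEIGHT `h`
# `∫_{Ω R} ‖θ(x̄ · mk g₁ · x̄⁻¹)‖ dμ' ≤ M_θ · (c · C(m) · 3(2(R + 6h + L₀)+1)² · |Δ(d)|⁻¹)`, `|Δ(d)²| = q^{-L₀}` (Harish-Chandra 1970, VII §3 p. 72)

Cell `pub/hodgecm-mathlib` (D-0151), Track B «K2-LIT», crux H413 = `stmt-HodgeConjecture-24833`, route of record `HCCMUnconditional`.  Lane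
`--supports stmt-HodgeConjecture-24833 --as helper`; THEOREMS ONLY (no `def`, no `instance`, no `notation`, no named-fact hypothesis, no `sorry`); count-neutral.

The a.e. point `x̄ ∈ G'` of the ASM is represented by an INTEGRAL `g₁` with `ϖ^h g₁⁻¹` integral (`h` = the height of `x̄`, ★ B4-0 `exists_zpow_scalar_mul_integral_of_adBall` + ★
`mk_scalar_zpow_mul`); in the split case `g₁ = y · diag d · y⁻¹` with `d` injective (★ `ae_isCompact_centralizer_or_normalForm`).  Then the eigenvalues are integral (★
`v_eigenvalue_le_one_of_conj`), `𝔅_h(g₁)` holds, the depth hypothesis of ★ T18-split holds with `L = L₀`, `|Δ(d)²| = q^{-L₀}`, and ★ `exists_setIntegral_norm_conj_le_split`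
gives the bound — in a shape whose only `x̄`-dependence is through `(R, h, L₀, |Δ(d)|)`, ready for the weight `W(x̄)` of the final assembly.
* `adBall_of_integral_of_inv`, `glDiagonal_mk0_eq`, **`exists_setIntegral_norm_conj_le_of_integral_split`**.
HONEST LABEL: HC_CM is proved only modulo the 7 printed citations (2 remaining named inputs: hLiu418 = stmt-HodgeConjecture-24832, h413 = stmt-HodgeConjecture-24833) until
rung 0 closes; count-neutral helper, closes no socket.

## References
* [HarishChandra1970] Harish-Chandra (notes by G. van Dijk), *Harmonic Analysis on Reductive p-adic Groups*, LNM 162 (1970), Part VII §2 Theorem 18 p. 69, §3 p. 72.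
-/

set_option autoImplicit false
-- the mandated namespace repeats the single-problem summit's segment (`HodgeConjecture.HodgeConjecture`)
set_option linter.dupNamespace false

noncomputable section

open MeasureTheory Measure Set
open scoped MatrixGroups NNReal ENNReal WithZero
open Literature.NumberTheory.Automorphic Literature.NumberTheory.GaloisRepresentations Literature.NumberTheory.GaloisRepresentations.IsNonarchimedeanLocalField
open Summit.HodgeConjecture.HodgeConjecture.Cruxes.H413.K2E3GLnAdHeightBalls Summit.HodgeConjecture.HodgeConjecture.Cruxes.H413.K2E3GL3TruncatedCharSplitTorusRadius
open Summit.HodgeConjecture.HodgeConjecture.Cruxes.H413.K2E3GL3ModUniformizerBallBoundSplit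

namespace Summit.HodgeConjecture.HodgeConjecture.Cruxes.H413.K2E3GL3ModUniformizerNonEllBallSplit

section Algebra

variable {F : Type*} [Field F]

/-- If `(g : Matrix) = y · diag d · y⁻¹` then every `d i ≠ 0` and `g = y · glDiagonal (mk0 ∘ d) · y⁻¹` in `GL₃`. [folklore] -/
theorem exists_glDiagonal_conj_eq {g y : GL (Fin 3) F} {d : Fin 3 → F}
    (hg : (g : Matrix (Fin 3) (Fin 3) F) = (y : Matrix (Fin 3) (Fin 3) F) * Matrix.diagonal d * ((y⁻¹ : GL (Fin 3) F) : Matrix (Fin 3) (Fin 3) F)) :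
    ∃ hd : ∀ i, d i ≠ 0, g = y * glDiagonal 3 F (fun i => Units.mk0 (d i) (hd i)) * y⁻¹ := by
  have hdet : (Matrix.diagonal d).det ≠ 0 := by
    intro h0
    have h1 : (g : Matrix (Fin 3) (Fin 3) F).det = 0 := by rw [hg, Matrix.det_mul, Matrix.det_mul, h0, mul_zero, zero_mul]
    exact (Matrix.det_ne_zero_of_left_inverse (B := ((g⁻¹ : GL (Fin 3) F) : Matrix (Fin 3) (Fin 3) F))
      (by rw [← Units.val_mul, inv_mul_cancel, Units.val_one])) h1
  have hd : ∀ i, d i ≠ 0 := by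
    intro i h0
    apply hdet
    rw [Matrix.det_diagonal]
    exact Finset.prod_eq_zero (Finset.mem_univ i) h0
  refine ⟨hd, Units.ext ?_⟩
  simp only [Units.val_mul, coe_glDiagonal, hg, Units.val_mk0]

variable [Valued F ℤᵐ⁰]

/-- **`g₁` integral and `ϖ^h g₁⁻¹` integral ⇒ `𝔅_h(g₁)`**. [folklore] -/
theorem adBall_of_integral_of_inv {ϖ : F} {h : ℕ} {g : GL (Fin 3) F} (hint : ∀ i j, Valued.v ((g : Matrix (Fin 3) (Fin 3) F) i j) ≤ 1)
    (hinv : ∀ i j, Valued.v (ϖ ^ h * ((g⁻¹ : GL (Fin 3) F) : Matrix (Fin 3) (Fin 3) F) i j) ≤ 1) (i j k l : Fin 3) :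
    Valued.v (ϖ ^ h * ((g : Matrix (Fin 3) (Fin 3) F) i j * ((g⁻¹ : GL (Fin 3) F) : Matrix (Fin 3) (Fin 3) F) k l)) ≤ 1 := by
  rw [mul_left_comm, map_mul]
  exact mul_le_one' (hint i j) (hinv k l)

end Algebra

variable {F : Type*} [Field F] [Valued F ℤᵐ⁰] [ValuativeRel F] [(Valued.v : Valuation F ℤᵐ⁰).Compatible] [IsNonarchimedeanLocalField F]
  [MeasurableSpace (GL (Fin 3) F)] [BorelSpace (GL (Fin 3) F)]
  {ϖ : F} (hϖ : Valued.v ϖ = WithZero.exp (-1 : ℤ)) (hϖ0 : ϖ ≠ 0)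
  [((Subgroup.zpowers (Units.mk0 ϖ hϖ0)).map (Matrix.GeneralLinearGroup.scalar (Fin 3))).Normal]
  [MeasurableSpace (GL (Fin 3) F ⧸ (Subgroup.zpowers (Units.mk0 ϖ hϖ0)).map (Matrix.GeneralLinearGroup.scalar (Fin 3)))]
  [BorelSpace (GL (Fin 3) F ⧸ (Subgroup.zpowers (Units.mk0 ϖ hϖ0)).map (Matrix.GeneralLinearGroup.scalar (Fin 3)))]
  (μ' : Measure (GL (Fin 3) F ⧸ (Subgroup.zpowers (Units.mk0 ϖ hϖ0)).map (Matrix.GeneralLinearGroup.scalar (Fin 3)))) [μ'.IsHaarMeasure]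

include hϖ in
/-- **THE SPLIT BALL BOUND AT AN INTEGRAL REPRESENTATIVE.**  Constants `c`, `C` as in ★ `exists_setIntegral_norm_conj_le_split`; for `θ` bounded by `M_θ`, vanishing off `Ω m`;
`g₁` INTEGRAL with `ϖ^h g₁⁻¹` integral and `(g₁ : Matrix) = y · diag d · y⁻¹`, `d` injective; `L₀` with `|Δ(d)²| = q^{-L₀}` (`Δ(d) = (d₀−d₁)(d₀−d₂)(d₁−d₂)`); any `R`:
`∫_{Ω R} ‖θ(x̄ · mk g₁ · x̄⁻¹)‖ dμ' ≤ M_θ · (c · (C m · 3(2(R + (6h + L₀))+1)² · |Δ(d)|⁻¹)).toReal`. [cite: HarishChandra1970, Part VII §2 Theorem 18 p. 69; §3 p. 72] -/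
theorem exists_setIntegral_norm_conj_le_of_integral_split {E : Type*} [NormedAddCommGroup E]
    (Ω : ℕ → Set (GL (Fin 3) F ⧸ (Subgroup.zpowers (Units.mk0 ϖ hϖ0)).map (Matrix.GeneralLinearGroup.scalar (Fin 3))))
    (hmem : ∀ (n : ℕ) (z : GL (Fin 3) F),
      (QuotientGroup.mk z : GL (Fin 3) F ⧸ (Subgroup.zpowers (Units.mk0 ϖ hϖ0)).map (Matrix.GeneralLinearGroup.scalar (Fin 3))) ∈ Ω n ↔
        ∀ i j k l, Valued.v (ϖ ^ n * ((z : Matrix (Fin 3) (Fin 3) F) i j * ((z⁻¹ : GL (Fin 3) F) : Matrix (Fin 3) (Fin 3) F) k l)) ≤ 1) :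
    ∃ (c : ℝ≥0) (C : ℕ → ℝ≥0∞), (∀ m, C m ≠ ⊤) ∧
      ∀ (θ : GL (Fin 3) F ⧸ (Subgroup.zpowers (Units.mk0 ϖ hϖ0)).map (Matrix.GeneralLinearGroup.scalar (Fin 3)) → E) (Mθ : ℝ) (m : ℕ),
        (∀ x, ‖θ x‖ ≤ Mθ) → (∀ x, x ∉ Ω m → θ x = 0) →
        ∀ (g₁ y : GL (Fin 3) F) (d : Fin 3 → F) (h L₀ R : ℕ), Function.Injective d →
          (g₁ : Matrix (Fin 3) (Fin 3) F) = (y : Matrix (Fin 3) (Fin 3) F) * Matrix.diagonal d * ((y⁻¹ : GL (Fin 3) F) : Matrix (Fin 3) (Fin 3) F) →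
          (∀ i j, Valued.v ((g₁ : Matrix (Fin 3) (Fin 3) F) i j) ≤ 1) → (∀ i j, Valued.v (ϖ ^ h * ((g₁⁻¹ : GL (Fin 3) F) : Matrix (Fin 3) (Fin 3) F) i j) ≤ 1) →
          Valued.v (((d 0 - d 1) * (d 0 - d 2) * (d 1 - d 2)) ^ 2) = WithZero.exp (-(L₀ : ℤ)) →
          ∫ x in Ω R, ‖θ (x * QuotientGroup.mk g₁ * x⁻¹)‖ ∂μ' ≤
            Mθ * ((c : ℝ≥0∞) * (C m * ((3 * (2 * (R + (6 * h + L₀)) + 1) ^ 2 : ℕ) : ℝ≥0∞) *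
              ((normAbs F ((d 0 - d 1) * (d 0 - d 2) * (d 1 - d 2)))⁻¹ : ℝ≥0))).toReal := by
  obtain ⟨c, C, hC, hmouth⟩ := exists_setIntegral_norm_conj_le_split (E := E) hϖ hϖ0 μ' Ω hmem
  refine ⟨c, C, hC, fun θ Mθ m hM hsupp g₁ y d h L₀ R hd hg hint hinv hL₀ => ?_⟩
  obtain ⟨hd0, hg'⟩ := exists_glDiagonal_conj_eq hg
  set t : Fin 3 → Fˣ := fun i => Units.mk0 (d i) (hd0 i) with ht
  have htd : ∀ i, (t i : F) = d i := fun i => rfl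
  -- distinct, integral eigenvalues
  have h01 : (t 0 : F) ≠ t 1 := fun h' => by have := hd (h' : d 0 = d 1); exact absurd this (by decide)
  have h02 : (t 0 : F) ≠ t 2 := fun h' => by have := hd (h' : d 0 = d 2); exact absurd this (by decide)
  have h12 : (t 1 : F) ≠ t 2 := fun h' => by have := hd (h' : d 1 = d 2); exact absurd this (by decide)
  have hy : ∀ i j, Valued.v ((((y * glDiagonal 3 F t * y⁻¹ : GL (Fin 3) F)) : Matrix (Fin 3) (Fin 3) F) i j) ≤ 1 := by rw [← hg']; exact hint
  have ht1 : ∀ i, Valued.v (t i : F) ≤ 1 := fun i => v_eigenvalue_le_one_of_conj (coe_glDiagonal 3 F t) hy i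
  -- `𝔅_h(g₁)` and the depth hypothesis with `L = L₀`
  have hs : ∀ i j k l, Valued.v (ϖ ^ h * (((y * glDiagonal 3 F t * y⁻¹ : GL (Fin 3) F) : Matrix (Fin 3) (Fin 3) F) i j *
      (((y * glDiagonal 3 F t * y⁻¹)⁻¹ : GL (Fin 3) F) : Matrix (Fin 3) (Fin 3) F) k l)) ≤ 1 := by
    rw [← hg']; exact adBall_of_integral_of_inv hint hinv
  have hϖL : Valued.v (ϖ ^ L₀) = WithZero.exp (-(L₀ : ℤ)) := by
    rw [map_pow, hϖ, ← WithZero.exp_nsmul]; congr 1; simp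
  have hL : Valued.v (ϖ ^ L₀ * ((t 0 : F) * t 1 * t 2) ^ 2) ≤ Valued.v ((((t 0 : F) - t 1) * ((t 0 : F) - t 2) * ((t 1 : F) - t 2)) ^ 2) := by
    simp only [htd]
    rw [map_mul, hϖL, ← hL₀]
    refine mul_le_of_le_one_right zero_le ?_
    rw [map_pow, map_mul, map_mul]
    exact pow_le_one₀ zero_le (mul_le_one' (mul_le_one' (ht1 0) (ht1 1)) (ht1 2))
  have key := hmouth θ Mθ m hM hsupp y t h01 h02 h12 ht1 h L₀ R hs hL
  rw [← hg'] at key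
  simpa only [htd] using key

end Summit.HodgeConjecture.HodgeConjecture.Cruxes.H413.K2E3GL3ModUniformizerNonEllBallSplit

end
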